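import Summits.CriticalPhenomena.PercolationContinuityZ3.Theorems.Transplant.PtsNetChart
import Summits.CriticalPhenomena.PercolationContinuityZ3.Theorems.Transplant.PlanarSkeletonFrmDefs
import HarnessLib

/-!
# `pts` IS A COMPLETE FOUR-TYPE `PlanarSkeletonFrm` CARRIER: the affine chart of `PtsNetChart` has connected induced cylinders (κ) —
# **`Pts.skeletonFrm : PlanarSkeletonFrm Pts.graph`** with `types.card = 4` (the sharpest test customer for the multi-type question)

builds on p205010 (kernel theorem, internal audit signed; external expert review pending) — nothing in this file uses p205010; NOTHING is claimed about
any node: the one-type frames-only nodes N2/U/U_s do not apply (`pts` has two vertex orbits, so no chart has transitive translating frames), and no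
multi-type frames-only node is typed (lane ruling (A4)).  What this file shows is that `pts` satisfies EVERY field of the frames-only interface.
Lane `prim-bschramm`, seat `prim-bschramm-p4` (gen 19; PART C3, `HOME/bschramm/P4-GENERAL.md` §41.4b).  Helper file
(`--supports stmt-CriticalPhenomena-4575 --as helper`).

* §1 (generic) `Skelφ.exists_reachable_fibre_of_steps`: under the step field (ι), inside the cylinder `{w | φ w − φ t ∈ box 2 ℓ}` every vertex is
  joined to a vertex OVER `φ t` (walk the chart coordinates down to `0`, one unit step at a time).
* §2 the fibres of the `pts` chart over the base values are the SPINES `{(n, n, c)}` (`Pts.chart_eq_base_iff`), and consecutive spine vertices are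
  joined inside the cylinder of half-width `1` by an explicit four-bond path for each class (`Pts.spine_step`).
* §3 **`Pts.skeletonFrm`** (φ = the affine chart, `lip`/`frame`/`step` from `PtsNetChart`, `Δ = 4`, (κ) from §1–§2), `Pts.skeletonFrm_types_card : … = 4`.
[cite: KozmaNitzan2024, §4 p. 15 (outward steps), p. 16 (Lemma 8: translating frames)] [cite: MartineauTassion2017, §3.2]
-/

namespace Summit.CriticalPhenomena.PercolationContinuityZ3.Theorems.Transplant

open Literature.Probability.Percolation Literature.Probability.LatticeModels SimpleGraph GridCover

/-! ## §1 Generic: descending to the base fibre inside a cylinder -/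

/-- **Inside a cylinder, every vertex is joined to a vertex over the base value** (for any chart with the step field (ι)): decrease `|d₀| + |d₁|`,
`d = φ w − φ t`, by unit steps; every intermediate vertex stays in the cylinder. [folklore] -/
theorem Skelφ.exists_reachable_fibre_of_steps {V : Type} {G : SimpleGraph V} [G.LocallyFinite] {φ : V → Site 2} (hstep : Skelφ.Steps G φ)
    (t : V) (ℓ : ℕ) (w : V) (hw : w ∈ {x | φ x - φ t ∈ box 2 ℓ}) :
    ∃ (w₀ : V) (h₀ : w₀ ∈ {x | φ x - φ t ∈ box 2 ℓ}), φ w₀ = φ t ∧ (G.induce {x | φ x - φ t ∈ box 2 ℓ}).Reachable ⟨w, hw⟩ ⟨w₀, h₀⟩ := by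
  suffices H : ∀ n : ℕ, ∀ (w : V) (hw : w ∈ {x | φ x - φ t ∈ box 2 ℓ}), ((φ w - φ t) 0).natAbs + ((φ w - φ t) 1).natAbs = n →
      ∃ (w₀ : V) (h₀ : w₀ ∈ {x | φ x - φ t ∈ box 2 ℓ}), φ w₀ = φ t ∧ (G.induce {x | φ x - φ t ∈ box 2 ℓ}).Reachable ⟨w, hw⟩ ⟨w₀, h₀⟩ from
    H _ w hw rfl
  intro n
  induction n using Nat.strong_induction_on with
  | _ n ih =>
    intro w hw hn
    set d : Site 2 := φ w - φ t with hd_def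
    have hbox : ∀ j, -(ℓ : ℤ) ≤ d j ∧ d j ≤ ℓ := mem_box.1 hw
    by_cases h0 : d 0 = 0 ∧ d 1 = 0
    · refine ⟨w, hw, ?_, Reachable.refl _⟩
      have : d = 0 := by funext j; fin_cases j <;> simp [h0.1, h0.2]
      exact sub_eq_zero.1 this
    obtain ⟨i, hi⟩ : ∃ i : Fin 2, d i ≠ 0 := by
      by_contra hc
      exact h0 ⟨not_not.1 fun h => hc ⟨0, h⟩, not_not.1 fun h => hc ⟨1, h⟩⟩
    -- the sign that moves `d i` towards `0`; the new value stays in `[−ℓ, ℓ]`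
    obtain ⟨s, hs1, hlt, hrange⟩ : ∃ s : ℤ, (s = 1 ∨ s = -1) ∧ (d i + s).natAbs < (d i).natAbs ∧ (-(ℓ : ℤ) ≤ d i + s ∧ d i + s ≤ ℓ) := by
      have hb := hbox i
      rcases lt_or_gt_of_ne hi with hlt | hgt
      · exact ⟨1, Or.inl rfl, by omega, by omega⟩
      · exact ⟨-1, Or.inr rfl, by omega, by omega⟩
    obtain ⟨σ, hσ⟩ : ∃ σ : ℤˣ, (σ : ℤ) = s := by
      rcases hs1 with rfl | rfl
      exacts [⟨1, rfl⟩, ⟨-1, rfl⟩]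
    obtain ⟨v', hadj, hφ⟩ := hstep w i σ
    have hdiff : φ v' - φ t = d + Pi.single i s := by rw [hφ, hσ, hd_def]; abel
    have hv' : v' ∈ {x | φ x - φ t ∈ box 2 ℓ} := by
      show φ v' - φ t ∈ box 2 ℓ
      rw [mem_box]
      intro j
      rw [hdiff, Pi.add_apply]
      by_cases hj : j = i
      · subst hj; rw [Pi.single_eq_same]; exact hrange
      · rw [Pi.single_eq_of_ne hj, add_zero]; exact hbox j
    have hlt' : ((φ v' - φ t) 0).natAbs + ((φ v' - φ t) 1).natAbs < n := by
      rw [← hn, hdiff]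
      fin_cases i <;> simp at hlt ⊢ <;> omega
    obtain ⟨w₀, h₀, hφ₀, hreach⟩ := ih _ hlt' v' hv' rfl
    exact ⟨w₀, h₀, hφ₀, (show (G.induce {x | φ x - φ t ∈ box 2 ℓ}).Adj ⟨w, hw⟩ ⟨v', hv'⟩ from hadj).reachable.trans hreach⟩

namespace Pts

/-! ## §2 The fibres over the base values are the spines; spine steps inside the unit cylinder -/

/-- The base vertex of class `c`. [folklore] -/
def base (c : Fin 4) : Site 3 := ![0, 0, ((c : ℕ) : ℤ)]

/-- `base c` has class `c`. [folklore] -/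
theorem cls_base (c : Fin 4) : TableNet.cls 3 (base c) = c :=
  (cls_eq_iff _ c).2 (by show ((((c : ℕ) : ℤ)) % 4) = _; have := c.isLt; omega)

/-- The chart at a base vertex. [folklore] -/
theorem chart_base (c : Fin 4) : chart (base c) = ![g₀ c, g₁ c] := by
  have h4 : (((c : ℕ) : ℤ)) / 4 = 0 := by have := c.isLt; omega
  funext i; fin_cases i
  · show chart (base c) 0 = g₀ c
    rw [chart_zero, cls_base]; simp [base, h4]
  · show chart (base c) 1 = g₁ c
    rw [chart_one, cls_base]; simp [base, h4]

/-- **The fibre of the chart over a base value is the spine** `{(n, n, c)}`: `chart x = chart (base c)` forces `x₀ = x₁` and `x₂ = c` (the offsets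
`g₀ − g₁ = 0, 2, 1, 3` separate the classes mod 4). [folklore] -/
theorem chart_eq_base_iff (x : Site 3) (c : Fin 4) : chart x = chart (base c) ↔ x 0 = x 1 ∧ x 2 = ((c : ℕ) : ℤ) := by
  obtain ⟨c', hc'⟩ : ∃ c', TableNet.cls 3 x = c' := ⟨_, rfl⟩
  have hx : x 2 % 4 = (c' : ℕ) := (cls_eq_iff x c').1 hc'
  constructor
  · intro h
    have h0 := congrFun h 0
    have h1 := congrFun h 1
    rw [chart_zero, hc', chart_base] at h0
    rw [chart_one, hc', chart_base] at h1
    simp only [Matrix.cons_val_zero, Matrix.cons_val_one] at h0 h1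
    fin_cases c <;> fin_cases c' <;> simp [g₀, g₁] at h0 h1 hx ⊢ <;> omega
  · rintro ⟨h01, h2⟩
    have hcx : TableNet.cls 3 x = c := (cls_eq_iff x c).2 (by rw [h2]; have := c.isLt; omega)
    have h4 : x 2 / 4 = 0 := by rw [h2]; have := c.isLt; omega
    rw [chart_base]
    funext i; fin_cases i
    · show chart x 0 = g₀ c
      rw [chart_zero, hcx]; omega
    · show chart x 1 = g₁ c
      rw [chart_one, hcx]; omega

/-- The cylinder of half-width `ℓ` at the base vertex of class `c`. [folklore] -/
abbrev cylSet (c : Fin 4) (ℓ : ℕ) : Set (Site 3) := {x | chart x - chart (base c) ∈ box 2 ℓ}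

/-- A spine vertex `(n, n, c)`. [folklore] -/
def spine (c : Fin 4) (n : ℤ) : Site 3 := ![n, n, ((c : ℕ) : ℤ)]

/-- Spine vertices lie over the base value. [folklore] -/
theorem chart_spine (c : Fin 4) (n : ℤ) : chart (spine c n) = chart (base c) :=
  (chart_eq_base_iff _ c).2 ⟨rfl, rfl⟩

/-- Spine vertices lie in every cylinder. [folklore] -/
theorem spine_mem (c : Fin 4) (ℓ : ℕ) (n : ℤ) : spine c n ∈ cylSet c ℓ := by
  show chart (spine c n) - chart (base c) ∈ box 2 ℓ
  rw [chart_spine, sub_self]; exact zero_mem_box 2 ℓ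

/-- An explicit vertex `(n + a, n + b, m)` near the spine: its chart relative to the base, given its class `c'` and `⌊m/4⌋ = q`. [folklore] -/
theorem chart_near (n a b m : ℤ) (c c' : Fin 4) (hc' : m % 4 = (c' : ℕ)) (q : ℤ) (hq : m / 4 = q) :
    chart ![n + a, n + b, m] - chart (base c) = ![a - b + 2 * q + (g₀ c' - g₀ c), a - b - 2 * q + (g₁ c' - g₁ c)] := by
  have hcl : TableNet.cls 3 ![n + a, n + b, m] = c' := (cls_eq_iff _ c').2 (by simpa using hc')
  rw [chart_base]
  funext i; fin_cases i
  · show chart ![n + a, n + b, m] 0 - _ = _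
    rw [chart_zero, hcl]; simp [hq]; ring
  · show chart ![n + a, n + b, m] 1 - _ = _
    rw [chart_one, hcl]; simp [hq]; ring

/-- Membership of a near-spine vertex in the unit cylinder, from its relative chart. [folklore] -/
theorem near_mem {ℓ : ℕ} (hℓ : 1 ≤ ℓ) (n a b m : ℤ) (c c' : Fin 4) (hc' : m % 4 = (c' : ℕ)) (q : ℤ) (hq : m / 4 = q)
    (h0 : |a - b + 2 * q + (g₀ c' - g₀ c)| ≤ 1) (h1 : |a - b - 2 * q + (g₁ c' - g₁ c)| ≤ 1) : (![n + a, n + b, m] : Site 3) ∈ cylSet c ℓ := by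
  show chart ![n + a, n + b, m] - chart (base c) ∈ box 2 ℓ
  rw [chart_near n a b m c c' hc' q hq, mem_box]
  have hℓ' : (1 : ℤ) ≤ ℓ := by exact_mod_cast hℓ
  intro i; fin_cases i
  · exact ⟨by have := (abs_le.1 h0).1; simp; omega, by have := (abs_le.1 h0).2; simp; omega⟩
  · exact ⟨by have := (abs_le.1 h1).1; simp; omega, by have := (abs_le.1 h1).2; simp; omega⟩

/-- Adjacency of two explicit near-spine vertices from the bond table. [folklore] -/
theorem adj_near (n a b m a' b' m' : ℤ) (c' : Fin 4) (hc' : m % 4 = (c' : ℕ)) (hd : (![a' - a, b' - b, m' - m] : Site 3) ∈ bonds c') :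
    graph.Adj ![n + a, n + b, m] ![n + a', n + b', m'] := by
  refine adj_of_mem ?_
  rw [(cls_eq_iff _ c').2 (by simpa using hc')]
  have e : (![n + a', n + b', m'] : Site 3) - ![n + a, n + b, m] = ![a' - a, b' - b, m' - m] := by
    funext i; fin_cases i <;> simp
  rw [e]; exact hd

/-- `spine c n` in near-spine form. [folklore] -/
theorem spine_eq (c : Fin 4) (n : ℤ) : spine c n = ![n + 0, n + 0, ((c : ℕ) : ℤ)] := by
  simp [spine]

/-- **One spine step inside the unit cylinder**: `(n, n, c)` is joined to `(n+1, n+1, c)` by four bonds whose intermediate vertices have relative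
chart in `{−1,0,1}²` (one explicit path per class, found by search). [folklore] -/
theorem spine_step {ℓ : ℕ} (hℓ : 1 ≤ ℓ) (c : Fin 4) (n : ℤ) :
    (graph.induce (cylSet c ℓ)).Reachable ⟨spine c n, spine_mem c ℓ n⟩ ⟨spine c (n + 1), spine_mem c ℓ (n + 1)⟩ := by
  -- a path `x₀ = spine n, x₁, x₂, x₃, x₄ = spine (n+1)` given by (a, b, m, class) data
  have mk : ∀ (a₁ b₁ m₁ : ℤ) (c₁ : Fin 4) (a₂ b₂ m₂ : ℤ) (c₂ : Fin 4) (a₃ b₃ m₃ : ℤ) (c₃ : Fin 4),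
      m₁ % 4 = (c₁ : ℕ) → m₂ % 4 = (c₂ : ℕ) → m₃ % 4 = (c₃ : ℕ) →
      (![n + a₁, n + b₁, m₁] : Site 3) ∈ cylSet c ℓ → (![n + a₂, n + b₂, m₂] : Site 3) ∈ cylSet c ℓ → (![n + a₃, n + b₃, m₃] : Site 3) ∈ cylSet c ℓ →
      graph.Adj ![n + 0, n + 0, ((c : ℕ) : ℤ)] ![n + a₁, n + b₁, m₁] → graph.Adj ![n + a₁, n + b₁, m₁] ![n + a₂, n + b₂, m₂] →
      graph.Adj ![n + a₂, n + b₂, m₂] ![n + a₃, n + b₃, m₃] → graph.Adj ![n + a₃, n + b₃, m₃] ![n + 1, n + 1, ((c : ℕ) : ℤ)] →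
      (graph.induce (cylSet c ℓ)).Reachable ⟨spine c n, spine_mem c ℓ n⟩ ⟨spine c (n + 1), spine_mem c ℓ (n + 1)⟩ := by
    intro a₁ b₁ m₁ c₁ a₂ b₂ m₂ c₂ a₃ b₃ m₃ c₃ _ _ _ h₁ h₂ h₃ e₀ e₁ e₂ e₃
    have s0 : (⟨spine c n, spine_mem c ℓ n⟩ : cylSet c ℓ) = ⟨![n + 0, n + 0, ((c : ℕ) : ℤ)], by rw [← spine_eq]; exact spine_mem c ℓ n⟩ :=
      Subtype.ext (spine_eq c n)
    have s4 : (⟨spine c (n + 1), spine_mem c ℓ (n + 1)⟩ : cylSet c ℓ) =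
        ⟨![n + 1, n + 1, ((c : ℕ) : ℤ)], by have := spine_mem c ℓ (n + 1); simpa [spine] using this⟩ :=
      Subtype.ext (by simp [spine])
    rw [s0, s4]
    have st : ∀ (x y : Site 3) (hx : x ∈ cylSet c ℓ) (hy : y ∈ cylSet c ℓ), graph.Adj x y → (graph.induce (cylSet c ℓ)).Reachable ⟨x, hx⟩ ⟨y, hy⟩ :=
      fun x y hx hy h => (show (graph.induce (cylSet c ℓ)).Adj ⟨x, hx⟩ ⟨y, hy⟩ from h).reachable
    exact (((st _ _ _ h₁ e₀).trans (st _ _ h₁ h₂ e₁)).trans (st _ _ h₂ h₃ e₂)).trans (st _ _ h₃ _ e₃)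
  have hc0 : ((((c : ℕ) : ℤ)) % 4) = (c : ℕ) := by have := c.isLt; omega
  fin_cases c
  · -- class 0: bonds (0,1,-1), (0,0,-2), (1,0,2), (0,0,1) through classes 3, 1, 3
    exact mk 0 1 (-1) 3 0 1 (-3) 1 1 1 (-1) 3 (by decide) (by decide) (by decide)
      (near_mem hℓ n 0 1 (-1) 0 3 (by decide) (-1) (by decide) (by decide) (by decide))
      (near_mem hℓ n 0 1 (-3) 0 1 (by decide) (-1) (by decide) (by decide) (by decide))
      (near_mem hℓ n 1 1 (-1) 0 3 (by decide) (-1) (by decide) (by decide) (by decide))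
      (adj_near n 0 0 0 0 1 (-1) 0 (by decide) (by decide)) (adj_near n 0 1 (-1) 0 1 (-3) 3 (by decide) (by decide))
      (adj_near n 0 1 (-3) 1 1 (-1) 1 (by decide) (by decide)) (adj_near n 1 1 (-1) 1 1 0 3 (by decide) (by decide))
  · -- class 1: bonds (1,0,1), (0,0,-2), (0,1,2), (0,0,-1) through classes 2, 0, 2
    exact mk 1 0 2 2 1 0 0 0 1 1 2 2 (by decide) (by decide) (by decide)
      (near_mem hℓ n 1 0 2 1 2 (by decide) 0 (by decide) (by decide) (by decide))
      (near_mem hℓ n 1 0 0 1 0 (by decide) 0 (by decide) (by decide) (by decide))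
      (near_mem hℓ n 1 1 2 1 2 (by decide) 0 (by decide) (by decide) (by decide))
      (adj_near n 0 0 1 1 0 2 1 (by decide) (by decide)) (adj_near n 1 0 2 1 0 0 2 (by decide) (by decide))
      (adj_near n 1 0 0 1 1 2 0 (by decide) (by decide)) (adj_near n 1 1 2 1 1 1 2 (by decide) (by decide))
  · -- class 2: bonds (0,0,-2), (0,1,2), (0,0,-1), (1,0,1) through classes 0, 2, 1
    exact mk 0 0 0 0 0 1 2 2 0 1 1 1 (by decide) (by decide) (by decide)
      (near_mem hℓ n 0 0 0 2 0 (by decide) 0 (by decide) (by decide) (by decide))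
      (near_mem hℓ n 0 1 2 2 2 (by decide) 0 (by decide) (by decide) (by decide))
      (near_mem hℓ n 0 1 1 2 1 (by decide) 0 (by decide) (by decide) (by decide))
      (adj_near n 0 0 2 0 0 0 2 (by decide) (by decide)) (adj_near n 0 0 0 0 1 2 0 (by decide) (by decide))
      (adj_near n 0 1 2 0 1 1 2 (by decide) (by decide)) (adj_near n 0 1 1 1 1 2 1 (by decide) (by decide))
  · -- class 3: bonds (0,0,-2), (1,0,2), (0,0,1), (0,1,-1) through classes 1, 3, 0
    exact mk 0 0 1 1 1 0 3 3 1 0 4 0 (by decide) (by decide) (by decide)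
      (near_mem hℓ n 0 0 1 3 1 (by decide) 0 (by decide) (by decide) (by decide))
      (near_mem hℓ n 1 0 3 3 3 (by decide) 0 (by decide) (by decide) (by decide))
      (near_mem hℓ n 1 0 4 3 0 (by decide) 1 (by decide) (by decide) (by decide))
      (adj_near n 0 0 3 0 0 1 3 (by decide) (by decide)) (adj_near n 0 0 1 1 0 3 1 (by decide) (by decide))
      (adj_near n 1 0 3 1 0 4 3 (by decide) (by decide)) (adj_near n 1 0 4 1 1 3 0 (by decide) (by decide))

/-- **Every spine vertex is joined to the base vertex inside the unit cylinder.** [folklore] -/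
theorem spine_reachable_base {ℓ : ℕ} (hℓ : 1 ≤ ℓ) (c : Fin 4) (n : ℤ) :
    (graph.induce (cylSet c ℓ)).Reachable ⟨spine c n, spine_mem c ℓ n⟩ ⟨spine c 0, spine_mem c ℓ 0⟩ := by
  suffices H : ∀ k : ℕ, ∀ n : ℤ, n.natAbs = k →
      (graph.induce (cylSet c ℓ)).Reachable ⟨spine c n, spine_mem c ℓ n⟩ ⟨spine c 0, spine_mem c ℓ 0⟩ from H _ n rfl
  intro k
  induction k with
  | zero => intro n hn; have : n = 0 := Int.natAbs_eq_zero.1 hn; subst this; rfl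
  | succ k ih =>
    intro n hn
    rcases lt_or_gt_of_ne (show n ≠ 0 by intro h; subst h; simp at hn) with hneg | hpos
    · have h := spine_step hℓ c n
      exact h.trans (ih (n + 1) (by omega))
    · have h := (spine_step hℓ c (n - 1)).symm
      rw [show n - 1 + 1 = n by ring] at h
      exact h.trans (ih (n - 1) (by omega))

/-! ## §3 The complete frames-only skeleton -/

/-- The base set of `PtsNetChart` is the set of the four `base c`. [folklore] -/
theorem mem_types_iff (t : Site 3) : t ∈ types ↔ ∃ c, t = base c := by
  constructor
  · intro h
    simp only [types, Finset.mem_insert, Finset.mem_singleton] at h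
    rcases h with rfl | rfl | rfl | rfl
    · exact ⟨0, rfl⟩
    · exact ⟨1, rfl⟩
    · exact ⟨2, rfl⟩
    · exact ⟨3, rfl⟩
  · rintro ⟨c, rfl⟩
    fin_cases c <;> simp [types, base]

/-- **(κ) for `pts`**: every induced cylinder of half-width `ℓ ≥ 1` at a base vertex is connected — descend to the fibre (§1), which is the spine
(§2), then walk the spine. [folklore] -/
theorem cyl_connected {ℓ : ℕ} (hℓ : 1 ≤ ℓ) (c : Fin 4) : (graph.induce (cylSet c ℓ)).Connected := by
  haveI : Nonempty (cylSet c ℓ) := ⟨⟨spine c 0, spine_mem c ℓ 0⟩⟩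
  refine Connected.mk fun a b => ?_
  have key : ∀ a : cylSet c ℓ, (graph.induce (cylSet c ℓ)).Reachable a ⟨spine c 0, spine_mem c ℓ 0⟩ := by
    rintro ⟨x, hx⟩
    obtain ⟨w₀, h₀, hφ, hr⟩ := Skelφ.exists_reachable_fibre_of_steps steps (base c) ℓ x hx
    obtain ⟨h01, h2⟩ := (chart_eq_base_iff w₀ c).1 hφ
    have hw₀ : w₀ = spine c (w₀ 0) := by
      funext i; fin_cases i
      · rfl
      · exact h01.symm
      · exact h2
    have e : (⟨w₀, h₀⟩ : cylSet c ℓ) = ⟨spine c (w₀ 0), spine_mem c ℓ _⟩ := Subtype.ext hw₀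
    rw [e] at hr
    exact hr.trans (spine_reachable_base hℓ c _)
  exact (key a).trans (key b).symm

/-- **`pts` IS A `PlanarSkeletonFrm` CARRIER (four types)** — every field of the frames-only interface: the affine chart, 1-Lipschitz, translating
frames, degree `4`, outward unit steps, connected cylinders.  Not a customer of any typed node (one-type nodes: two orbits; multi-type: (A4)).
[cite: KozmaNitzan2024, §4 p. 15, p. 16 (Lemma 8)] [cite: MartineauTassion2017, §3.2] -/
noncomputable def skeletonFrm : PlanarSkeletonFrm graph where
  φ := chart
  lip := lip
  types := types
  frame := frames
  Δ := 4
  degree_le := fun v => (degree_eq v).le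
  step := steps
  cyl_connected := by
    intro t ht ℓ hℓ
    obtain ⟨c, rfl⟩ := (mem_types_iff t).1 ht
    exact cyl_connected hℓ c

/-- The skeleton has exactly FOUR base types. [folklore] -/
theorem skeletonFrm_types_card : skeletonFrm.types.card = 4 := by
  show types.card = 4
  decide

end Pts

end Summit.CriticalPhenomena.PercolationContinuityZ3.Theorems.Transplant
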